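import Literature.NumberTheory.QuadraticFields.IntegralBasisConjugation
import Literature.NumberTheory.QuadraticFields.SquareRootGenerator
import Mathlib.NumberTheory.NumberField.Norm
import Mathlib.NumberTheory.NumberField.CMField
import Mathlib.NumberTheory.NumberField.Cyclotomic.Basic
import Mathlib.NumberTheory.LegendreSymbol.Basic
import Mathlib.Data.Rat.Lemmas
import HarnessLib

/-!
# Weil-type family coverage — THEOREM L (i) at the census level `M = 21`, elementary: every unit of a
# number field containing `√D` (`q ∣ D` prime, `q ≡ 3 (mod 4)`, `q² ∤ D`) has norm `+1`; `√21 ∈ ℚ(ζ₂₁)⁺`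

research route conditional on HC_CM; not a corollary; Q11.4-sentence-2 already refuted in dim ≥ 3.

Ring 2, WEIL-TYPE FAMILY-COVERAGE CENSUS (`HOME/WEIL-FAMILY-COVERAGE.md` `## b01`, block b01.28 THEOREM L (i)
«no unit of `ℚ(ζ_M)⁺` has norm `−1` for `M` not a prime power» — there by class field theory; and ring2-b06
g94's remark (b06.14, adopted in b01.28) «no unit of norm −1 is elementary whenever `ℚ(ζ_M)⁺ ⊇ ℚ(√D′)` with a
prime `q ≡ 3 (4)` dividing `D′`», owner ring2-b01), part 8 of the `Ring2WeilCoverage*` series.  Part 7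
(`…CyclotomicPrincipalObstruction`) proved the census's NO verdict on `ℂ^Φ/Φ(ℤ[ζₙ])` modulo the ONE hypothesis
`hN : ∀ v ∈ 𝓞(ℚ(ζₙ)⁺)ˣ, 0 < N(v)`.  This file DISCHARGES `hN` at `n = 21` (and gives the template for
`28, 33, 36, 44`: `√7, √33, √3, √11`), with no class field theory:

* §1 `no_norm_neg_one_core` (arithmetic): `m = a² + 4` and `m = D·w²` (`w ∈ ℚ`) is impossible when a prime
  `q ≡ 3 (mod 4)` divides `D` but `q² ∤ D` (clear denominators: `q ∣ m`, so `a² ≡ −4 (mod q)` and `−1` would be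
  a square mod `q` — Mathlib `ZMod.exists_sq_eq_neg_one_iff`).
* §2 **`norm_ne_neg_one`**: in a quadratic field `F ∋ θ ∉ ℚ`, `θ² = D` as above, NO algebraic integer has norm
  `−1`: with the lane's integral basis `(1, τ)`, `τ² = m + ετ` (`QuadraticFields.Quadratic.TauData`) the norm
  form is `u² + εuv − mv²` (`TauData.coe_norm`: `N(x) = x·σx`), `4N = (2u+εv)² − d_F v²` (`d_F = ε + 4m`,
  `TauData.discr_eq`), and `d_F = D·c²`, `c ∈ ℚˣ` (`NumberField.exists_discr_eq_mul_sq`); `N = −1` gives §1's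
  impossible pair.
* §3 **`norm_units_eq_one` / `norm_units_eq_one_of_sq_eq`: every unit of ANY number field `L ∋ θ`, `θ² = D`
  (`D` not a square, `q` as above), has `N_{L/ℚ} = +1`** — `N_{L/ℚ} = N_{F/ℚ} ∘ N_{L/F}` with `F = ℚ(θ)`
  (Mathlib `RingOfIntegers.norm`, `isUnit_norm`, `Algebra.norm_norm`), and a unit of `𝓞_F` has norm `±1 ≠ −1`.
* §4 **`ℚ(ζ₂₁)`**: `θ₀ := (1 + 2ζ⁷)(1 + 2(ζ³ + ζ⁶ + ζ¹²))` (`= √−3·√−7` by the Gauss periods of `3` and `7`) has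
  `θ₀² = 21` (`sq_sqrtTwentyOne`) and is fixed by complex conjugation (`complexConj_sqrtTwentyOne`), so lies in
  `ℚ(ζ₂₁)⁺`; hence **`norm_realUnits_pos_twentyOne`: every unit `v` of `𝓞(ℚ(ζ₂₁)⁺)` has `0 < N_{ℚ(ζ₂₁)⁺/ℚ}(v)`**
  (`q = 3`: `3 ∣ 21`, `9 ∤ 21`, `3 ≡ 3 (mod 4)`) — the hypothesis `hN` of part 7 at `n = 21`, PROVED.

HONEST FRAMING: elementary algebraic number theory (norm forms of quadratic orders, transitivity of norms);
THEOREM L (i) in general (every non-prime-power `M`, via Hilbert reciprocity) is NOT proved — only the levels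
whose maximal real subfield contains such a `√D` are covered by this route (`21, 28, 33, 36, 44` among the census
levels; NOT `35, 45`, whose only real quadratic subfield is `ℚ(√5)`); nothing here mentions Hodge classes, `W_K`
or HC; `HC_CM` is used nowhere.  No `def`, no named fact, no `sorry`.

References: the norm form / discriminant of a quadratic field [cite: Cox2013, §7.A]; [folklore] for the rest;
census b01.28 THEOREM L (i) and b06.14's remark (seat-derived).
-/

noncomputable section

open Module NumberField Polynomial

namespace Summit.HodgeConjecture.Ring2WeilCoverage.RealQuadraticUnitNorm

open Literature.NumberTheory.QuadraticFields.Quadratic IntermediateField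

/-! ### §1 The arithmetic core -/

/-- **Arithmetic core**: if `q ≡ 3 (mod 4)` is a prime with `q ∣ D`, `q² ∤ D`, then no `a m : ℤ`, `w : ℚ`
satisfy `m = a² + 4` and `m = D·w²`.  (Clearing the denominator of `w`: `q ∣ m` — else `q ∣ den w` forces
`q² ∣ D` — so `a² ≡ −4 (mod q)`, i.e. `−1` is a square mod `q`.)
research route conditional on HC_CM; not a corollary; Q11.4-sentence-2 already refuted in dim ≥ 3. [folklore] -/
theorem no_norm_neg_one_core {D : ℕ} {q : ℕ} (hq : q.Prime) (hq4 : q % 4 = 3) (hqD : q ∣ D)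
    (hqqD : ¬ q ^ 2 ∣ D) {a m : ℤ} {w : ℚ} (hm : m = a ^ 2 + 4) (hw : (m : ℚ) = D * w ^ 2) : False := by
  haveI := Fact.mk hq
  have hqZ : Prime (q : ℤ) := Nat.prime_iff_prime_int.mp hq
  have hwd : w ^ 2 * (w.den : ℚ) ^ 2 = (w.num : ℚ) ^ 2 := by rw [← mul_pow, Rat.mul_den_eq_num]
  have key : m * (w.den : ℤ) ^ 2 = D * w.num ^ 2 := by
    have h2 : ((m * (w.den : ℤ) ^ 2 : ℤ) : ℚ) = ((D * w.num ^ 2 : ℤ) : ℚ) := by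
      push_cast
      rw [hw, mul_assoc, hwd]
    exact_mod_cast h2
  have hqm : (q : ℤ) ∣ m := by
    have hqDz : (q : ℤ) ∣ (D : ℤ) := by exact_mod_cast hqD
    have h1 : (q : ℤ) ∣ m * (w.den : ℤ) ^ 2 := by rw [key]; exact dvd_mul_of_dvd_left hqDz _
    rcases hqZ.dvd_or_dvd h1 with h | h
    · exact h
    · exfalso
      have hqden : (q : ℤ) ∣ w.den := hqZ.dvd_of_dvd_pow h
      have hqnum : ¬ (q : ℤ) ∣ w.num := by
        intro h'
        have h'' : q ∣ w.num.natAbs := Int.natCast_dvd.mp h'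
        have hqden' : q ∣ w.den := by exact_mod_cast hqden
        exact hq.one_lt.ne' (Nat.eq_one_of_dvd_coprimes w.reduced h'' hqden')
      obtain ⟨d, hd⟩ := hqden
      have h2 : (q : ℤ) ^ 2 ∣ (D : ℤ) * w.num ^ 2 := by
        rw [← key, hd]; exact ⟨m * d ^ 2, by ring⟩
      have hcop : IsCoprime ((q : ℤ) ^ 2) (w.num ^ 2) := ((Prime.coprime_iff_not_dvd hqZ).mpr hqnum).pow
      have h3 : (q : ℤ) ^ 2 ∣ (D : ℤ) := hcop.dvd_of_dvd_mul_right h2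
      exact hqqD (by exact_mod_cast h3)
  have hsq : IsSquare (-1 : ZMod q) := by
    have h2 : ((a : ZMod q)) ^ 2 + 4 = 0 := by
      have : ((m : ℤ) : ZMod q) = 0 := by
        rw [ZMod.intCast_zmod_eq_zero_iff_dvd]; exact hqm
      rw [hm] at this; push_cast at this; exact this
    have hq2 : (2 : ZMod q) ≠ 0 := by
      intro h
      have h' : ((2 : ℕ) : ZMod q) = 0 := by exact_mod_cast h
      rw [ZMod.natCast_eq_zero_iff] at h'
      have := Nat.le_of_dvd two_pos h'
      have := hq.two_le
      omega
    refine ⟨(a : ZMod q) * 2⁻¹, ?_⟩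
    have : ((a : ZMod q)) ^ 2 = -4 := by linear_combination h2
    field_simp
    rw [this]
    norm_num
  exact (ZMod.exists_sq_eq_neg_one_iff (p := q)).mp hsq hq4

/-! ### §2 Quadratic fields: no algebraic integer of norm `−1` -/

/-- **No algebraic integer of norm `−1` in `ℚ(√D)`** when a prime `q ≡ 3 (mod 4)` divides `D` and `q² ∤ D`:
for a quadratic field `F ∋ θ ∉ ℚ` with `θ² = D`, `N_{F/ℚ}(π) ≠ −1` for every `π ∈ 𝓞 F`.  Proof: on the lane's
integral basis `(1, τ)`, `τ² = m + ετ`, `π = u + vτ` has norm `u² + εuv − mv²`; `4N = (2u + εv)² − d_F v²` with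
`d_F = ε + 4m = D·c²` (`c ∈ ℚˣ`), and `N = −1` contradicts §1.
research route conditional on HC_CM; not a corollary; Q11.4-sentence-2 already refuted in dim ≥ 3. [cite: Cox2013, §7.A] -/
theorem norm_ne_neg_one {F : Type*} [Field F] [NumberField F] (h2 : finrank ℚ F = 2) {θ : F} {D q : ℕ}
    (hθ : θ ∉ Set.range (algebraMap ℚ F)) (hD : θ ^ 2 = (D : F)) (hq : q.Prime) (hq4 : q % 4 = 3)
    (hqD : q ∣ D) (hqq : ¬ q ^ 2 ∣ D) (π : 𝓞 F) : Algebra.norm ℤ π ≠ -1 := by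
  obtain ⟨T⟩ := nonempty_tauData h2
  obtain ⟨u, v, hπ⟩ := T.exists_int_coords π
  have hN : Algebra.norm ℤ π = u ^ 2 + T.ε * u * v - T.m * v ^ 2 := by
    -- `N(π) = π·σπ = (u + vτ)(u + v(ε − τ)) = u² + εuv − mv²` (`τ² = m + ετ`), read in `F`
    have h1 := T.coe_norm h2 π
    rw [T.σ_coe_of_coords h2 hπ] at h1
    have hπF : (π : F) = (u : F) + (v : F) * (T.τ : F) := by
      have := congrArg (algebraMap (𝓞 F) F) hπ
      simp only [map_add, map_mul, map_intCast] at this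
      rw [← RingOfIntegers.coe_eq_algebraMap, ← RingOfIntegers.coe_eq_algebraMap] at this
      exact this
    have hτF : ((T.τ : 𝓞 F) : F) * ((T.τ : 𝓞 F) : F) = (T.m : F) + (T.ε : F) * (T.τ : F) := by
      have := congrArg (algebraMap (𝓞 F) F) T.τ_sq
      simp only [map_add, map_mul, map_intCast] at this
      rw [← RingOfIntegers.coe_eq_algebraMap] at this
      exact this
    rw [hπF] at h1
    have h3 : ((Algebra.norm ℤ π : ℤ) : F) = ((u ^ 2 + T.ε * u * v - T.m * v ^ 2 : ℤ) : F) := by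
      rw [h1]; push_cast; linear_combination (-((v : F) ^ 2)) * hτF
    exact_mod_cast h3
  have hd : NumberField.discr F = T.ε + 4 * T.m := T.discr_eq
  obtain ⟨c, -, hdisc⟩ := NumberField.exists_discr_eq_mul_sq h2 hθ (c := (D : ℚ)) (by rw [hD]; simp)
  intro hneg
  have hε := T.ε_sq
  have h1 : u ^ 2 + T.ε * u * v - T.m * v ^ 2 = -1 := hN.symm.trans hneg
  refine no_norm_neg_one_core hq hq4 hqD hqq (a := 2 * u + T.ε * v) (m := NumberField.discr F * v ^ 2)
    (w := c * v) ?_ ?_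
  · rw [hd]; linear_combination (-4) * h1 + (-(v ^ 2)) * hε
  · push_cast; rw [hdisc]; ring

/-! ### §3 Units of a number field containing such a quadratic field have norm `+1` -/

/-- **Transitivity**: for a tower `F ⊂ L` of number fields with `F` as in §2, every unit `u` of `𝓞 L` has
`N_{L/ℚ}(u) = 1` (`N_{L/ℚ}(u) = N_{F/ℚ}(N_{L/F} u)`, and `N_{L/F} u` is a unit of `𝓞 F`, of norm `±1 ≠ −1`).
research route conditional on HC_CM; not a corollary; Q11.4-sentence-2 already refuted in dim ≥ 3. [folklore] -/
theorem norm_units_eq_one {F L : Type*} [Field F] [NumberField F] [Field L] [NumberField L] [Algebra F L]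
    (h2 : finrank ℚ F = 2) {θ : F} {D q : ℕ} (hθ : θ ∉ Set.range (algebraMap ℚ F))
    (hD : θ ^ 2 = (D : F)) (hq : q.Prime) (hq4 : q % 4 = 3) (hqD : q ∣ D) (hqq : ¬ q ^ 2 ∣ D)
    (u : (𝓞 L)ˣ) : Algebra.norm ℚ (((u : 𝓞 L)) : L) = 1 := by
  haveI : FiniteDimensional F L := Module.Finite.of_restrictScalars_finite ℚ F L
  have hv : IsUnit (RingOfIntegers.norm F (u : 𝓞 L)) := (RingOfIntegers.isUnit_norm F).mpr u.isUnit
  have hvZ : IsUnit (Algebra.norm ℤ (RingOfIntegers.norm F (u : 𝓞 L))) := hv.map _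
  have hne := norm_ne_neg_one h2 hθ hD hq hq4 hqD hqq (RingOfIntegers.norm F (u : 𝓞 L))
  have h1 : Algebra.norm ℤ (RingOfIntegers.norm F (u : 𝓞 L)) = 1 := by
    rcases Int.isUnit_iff.mp hvZ with h | h
    · exact h
    · exact absurd h hne
  calc Algebra.norm ℚ (((u : 𝓞 L)) : L)
      = Algebra.norm ℚ (Algebra.norm F (((u : 𝓞 L)) : L)) := (Algebra.norm_norm (R := ℚ) (S := F)).symm
    _ = Algebra.norm ℚ (((RingOfIntegers.norm F (u : 𝓞 L)) : 𝓞 F) : F) := by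
        rw [RingOfIntegers.coe_norm]
    _ = ((Algebra.norm ℤ (RingOfIntegers.norm F (u : 𝓞 L)) : ℤ) : ℚ) := (Algebra.coe_norm_int _).symm
    _ = 1 := by rw [h1]; norm_num

/-- **Every unit of a number field `L ∋ θ`, `θ² = D` (`D` not a square; `q ∣ D` prime, `q ≡ 3 (mod 4)`,
`q² ∤ D`) has norm `+1`** (apply §3 to `F = ℚ(θ) ⊂ L`, a quadratic field since `θ ∉ ℚ` and `θ² ∈ ℚ`).
research route conditional on HC_CM; not a corollary; Q11.4-sentence-2 already refuted in dim ≥ 3. [folklore] -/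
theorem norm_units_eq_one_of_sq_eq {L : Type*} [Field L] [NumberField L] {θ : L} {D q : ℕ}
    (hD : θ ^ 2 = (D : L)) (hDsq : ¬ IsSquare D) (hq : q.Prime) (hq4 : q % 4 = 3) (hqD : q ∣ D)
    (hqq : ¬ q ^ 2 ∣ D) (u : (𝓞 L)ˣ) : Algebra.norm ℚ (((u : 𝓞 L)) : L) = 1 := by
  have hθL : θ ∉ Set.range (algebraMap ℚ L) := by
    rintro ⟨r, hr⟩
    apply hDsq
    have h1 : algebraMap ℚ L (r ^ 2) = algebraMap ℚ L (D : ℚ) := by rw [map_pow, hr, hD, map_natCast]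
    have h2 : r ^ 2 = (D : ℚ) := (algebraMap ℚ L).injective h1
    exact Rat.isSquare_natCast_iff.mp ⟨r, by rw [← h2, sq]⟩
  have hint : IsIntegral ℚ θ := Algebra.IsIntegral.isIntegral θ
  set F : IntermediateField ℚ L := ℚ⟮θ⟯ with hF
  haveI : NumberField F := NumberField.mk
  have h2 : finrank ℚ F = 2 := by
    rw [hF, adjoin.finrank hint]
    apply le_antisymm
    · have hp0 : (X ^ 2 - C (D : ℚ) : ℚ[X]) ≠ 0 := X_pow_sub_C_ne_zero two_pos _
      have hpθ : aeval θ (X ^ 2 - C (D : ℚ) : ℚ[X]) = 0 := by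
        simp only [map_sub, map_pow, aeval_X, map_natCast, hD, sub_self]
      have hdeg := minpoly.degree_le_of_ne_zero (A := ℚ) (x := θ) hp0 hpθ
      rw [degree_X_pow_sub_C two_pos] at hdeg
      exact natDegree_le_iff_degree_le.mpr hdeg
    · exact (minpoly.two_le_natDegree_iff hint).mpr (by rintro ⟨r, hr⟩; exact hθL ⟨r, hr⟩)
  set θ' : F := AdjoinSimple.gen ℚ θ with hθ'
  have hθ'L : algebraMap F L θ' = θ := AdjoinSimple.algebraMap_gen ℚ θ
  have hD' : θ' ^ 2 = (D : F) := by
    apply (algebraMap F L).injective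
    rw [map_pow, hθ'L, hD, map_natCast]
  have hθ' : θ' ∉ Set.range (algebraMap ℚ F) := by
    rintro ⟨r, hr⟩
    apply hθL
    refine ⟨r, ?_⟩
    rw [IsScalarTower.algebraMap_apply ℚ F L, hr, hθ'L]
  exact norm_units_eq_one h2 hθ' hD' hq hq4 hqD hqq u

/-! ### §4 `√21 ∈ ℚ(ζ₂₁)⁺`: the units of `ℚ(ζ₂₁)⁺` have norm `+1` (THEOREM L (i) at `M = 21`) -/

section CM

variable {K : Type*} [Field K] [NumberField K] [IsCMField K]

/-- Complex conjugation inverts a root of unity of a CM field (every embedding lands on the unit circle).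
research route conditional on HC_CM; not a corollary; Q11.4-sentence-2 already refuted in dim ≥ 3. [folklore] -/
theorem complexConj_eq_inv_of_pow_eq_one {ζ : K} {n : ℕ} (hn : n ≠ 0) (h : ζ ^ n = 1) :
    IsCMField.complexConj K ζ = ζ⁻¹ := by
  obtain ⟨φ⟩ := (inferInstance : Nonempty (K →+* ℂ))
  apply φ.injective
  rw [IsCMField.complexEmbedding_complexConj, map_inv₀,
    Complex.inv_eq_conj (Complex.norm_eq_one_of_pow_eq_one (by rw [← map_pow, h, map_one]) hn)]

omit [NumberField K] [IsCMField K] in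
/-- **`θ₀² = 21`** for `θ₀ = (1 + 2ζ⁷)(1 + 2(ζ³ + ζ⁶ + ζ¹²))`, `ζ` a primitive `21`-st root of unity:
`(1 + 2ω)² = −3` for the cube root `ω = ζ⁷` (`1 + ω + ω² = 0`) and `(1 + 2(η + η² + η⁴))² = −7` for the
`7`-th root `η = ζ³` (the Gauss period: `g² = g + 2g′`, `g + g′ = −1`).
research route conditional on HC_CM; not a corollary; Q11.4-sentence-2 already refuted in dim ≥ 3. [folklore] -/
theorem sq_sqrtTwentyOne {ζ : K} (hζ : IsPrimitiveRoot ζ 21) :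
    ((1 + 2 * ζ ^ 7) * (1 + 2 * (ζ ^ 3 + ζ ^ 6 + ζ ^ 12))) ^ 2 = (21 : K) := by
  have hω : IsPrimitiveRoot (ζ ^ 7) 3 := hζ.pow (by norm_num) (by norm_num)
  have hη : IsPrimitiveRoot (ζ ^ 3) 7 := hζ.pow (by norm_num) (by norm_num)
  have h3 := hω.geom_sum_eq_zero (by norm_num : 1 < 3)
  have h7 := hη.geom_sum_eq_zero (by norm_num : 1 < 7)
  simp only [Finset.sum_range_succ, Finset.sum_range_zero, zero_add, pow_zero, pow_one] at h3 h7
  have hη7 : (ζ ^ 3) ^ 7 = 1 := hη.pow_eq_one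
  have hA : (1 + 2 * ζ ^ 7) ^ 2 = -3 := by
    linear_combination (4 : K) * h3
  have hB : (1 + 2 * (ζ ^ 3 + ζ ^ 6 + ζ ^ 12)) ^ 2 = -7 := by
    have e6 : ζ ^ 6 = (ζ ^ 3) ^ 2 := by ring
    have e12 : ζ ^ 12 = (ζ ^ 3) ^ 4 := by ring
    rw [e6, e12]
    linear_combination (4 * ζ ^ 3) * hη7 + 8 * h7
  rw [mul_pow, hA, hB]; norm_num

/-- **`θ₀` is real**: complex conjugation (`ζ ↦ ζ⁻¹`) negates both factors `1 + 2ω` and `1 + 2(η + η² + η⁴)`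
(`ω⁻¹ = ω² = −1 − ω`; `η⁻¹ + η⁻² + η⁻⁴ = η⁶ + η⁵ + η³ = −1 − (η + η² + η⁴)`), hence fixes their product.
research route conditional on HC_CM; not a corollary; Q11.4-sentence-2 already refuted in dim ≥ 3. [folklore] -/
theorem complexConj_sqrtTwentyOne {ζ : K} (hζ : IsPrimitiveRoot ζ 21) :
    IsCMField.complexConj K ((1 + 2 * ζ ^ 7) * (1 + 2 * (ζ ^ 3 + ζ ^ 6 + ζ ^ 12))) =
      (1 + 2 * ζ ^ 7) * (1 + 2 * (ζ ^ 3 + ζ ^ 6 + ζ ^ 12)) := by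
  have hω : IsPrimitiveRoot (ζ ^ 7) 3 := hζ.pow (by norm_num) (by norm_num)
  have hη : IsPrimitiveRoot (ζ ^ 3) 7 := hζ.pow (by norm_num) (by norm_num)
  have h3 := hω.geom_sum_eq_zero (by norm_num : 1 < 3)
  have h7 := hη.geom_sum_eq_zero (by norm_num : 1 < 7)
  simp only [Finset.sum_range_succ, Finset.sum_range_zero, zero_add, pow_zero, pow_one] at h3 h7
  have hω3 : (ζ ^ 7) ^ 3 = 1 := hω.pow_eq_one
  have hη7 : (ζ ^ 3) ^ 7 = 1 := hη.pow_eq_one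
  have hc : IsCMField.complexConj K ζ = ζ⁻¹ :=
    complexConj_eq_inv_of_pow_eq_one (by norm_num) hζ.pow_eq_one
  have hcω : IsCMField.complexConj K (ζ ^ 7) = (ζ ^ 7) ^ 2 := by
    rw [map_pow, hc, inv_pow]
    exact inv_eq_of_mul_eq_one_right (by linear_combination hω3)
  have hcη : IsCMField.complexConj K (ζ ^ 3) = (ζ ^ 3) ^ 6 := by
    rw [map_pow, hc, inv_pow]
    exact inv_eq_of_mul_eq_one_right (by linear_combination hη7)
  have e6 : ζ ^ 6 = (ζ ^ 3) ^ 2 := by ring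
  have e12 : ζ ^ 12 = (ζ ^ 3) ^ 4 := by ring
  rw [e6, e12]
  simp only [map_mul, map_add, map_one, map_ofNat, map_pow, hcω, hcη]
  have hA' : (1 + 2 * (ζ ^ 7) ^ 2 : K) = -(1 + 2 * ζ ^ 7) := by linear_combination (2 : K) * h3
  have hB' : (1 + 2 * ((ζ ^ 3) ^ 6 + ((ζ ^ 3) ^ 6) ^ 2 + ((ζ ^ 3) ^ 6) ^ 4) : K) =
      -(1 + 2 * (ζ ^ 3 + (ζ ^ 3) ^ 2 + (ζ ^ 3) ^ 4)) := by
    linear_combination (2 : K) * h7 +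
      (2 * (ζ ^ 3) ^ 5 + 2 * (ζ ^ 3) ^ 3 * (((ζ ^ 3) ^ 7) ^ 2 + (ζ ^ 3) ^ 7 + 1)) * hη7
  rw [hA', hB']
  ring

/-- **THEOREM L (i) AT `M = 21`, PROVED: every unit `v` of `𝓞(ℚ(ζ₂₁)⁺)` has `0 < N_{ℚ(ζ₂₁)⁺/ℚ}(v)`**
(`ℚ(ζ₂₁)⁺ ∋ √21`, `3 ∣ 21`, `9 ∤ 21`, `3 ≡ 3 (mod 4)`; §3) — the hypothesis `hN` of part 7's
`CyclotomicPrincipalObstruction.not_exists_principal_of_norm_pos_of_odd` /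
`not_exists_principal_twentyOne_sqrt_neg_three` at `n = 21`, for any `K` with `IsCyclotomicExtension {21} ℚ K`.
research route conditional on HC_CM; not a corollary; Q11.4-sentence-2 already refuted in dim ≥ 3. [folklore] -/
theorem norm_realUnits_pos_twentyOne [IsCyclotomicExtension {21} ℚ K] {ζ : K} (hζ : IsPrimitiveRoot ζ 21)
    (v : (𝓞 (maximalRealSubfield K))ˣ) :
    0 < Algebra.norm ℚ (((v : 𝓞 (maximalRealSubfield K)) : maximalRealSubfield K)) := by
  set θ₀ : K := (1 + 2 * ζ ^ 7) * (1 + 2 * (ζ ^ 3 + ζ ^ 6 + ζ ^ 12)) with hθ₀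
  have hmem : θ₀ ∈ maximalRealSubfield K :=
    (IsCMField.complexConj_eq_self_iff K θ₀).mp (complexConj_sqrtTwentyOne hζ)
  set θ : maximalRealSubfield K := ⟨θ₀, hmem⟩ with hθ
  have hD : θ ^ 2 = ((21 : ℕ) : maximalRealSubfield K) := by
    apply Subtype.ext
    push_cast
    exact sq_sqrtTwentyOne hζ
  have hsq : ¬ IsSquare (21 : ℕ) := by
    rintro ⟨r, hr⟩
    have hr5 : r ≤ 5 := by nlinarith
    interval_cases r <;> omega
  rw [norm_units_eq_one_of_sq_eq hD hsq Nat.prime_three (by norm_num) (by norm_num) (by norm_num) v]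
  norm_num

end CM

end Summit.HodgeConjecture.Ring2WeilCoverage.RealQuadraticUnitNorm

end
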